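import Mathlib
import Summits.Ventures.PercRepro2.RowC1AvoidComb

/-!
# Exploring the `b`-avoiding cluster: the tower identities for `Q ∩ {b ∈ C₂}` and `Q`
(blind cell PercRepro2, p2 g29; proofs/P2-G29-E1.md §2, Lemma 1, part 2 of 3)

With `K(ω) = C_{G−b}(a₂)` (`avoidCluster`), the attachment event `attachEvent ends b W` = {some edge
from `b` into `W` is open}, the avoidance event `delAvoidEvent ends W b a₁` = {`b ↮ a₁` in `G − W`},
`σ(W) = P(attach)`, `ρ(W) = 1 − σ(W)`, `ζ(W) = P(delAvoid)` and `c(W) = 1_𝓒(W) · 1[a₁ ∉ W]`: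

* **`prob_bH_Q_eq_expect`**: `P(Q, b ∈ C₂, K ∈ 𝓒) = E[c(K) · σ(K) · ζ(K)]`;
* **`prob_Q_eq_expect`**: `P(Q, K ∈ 𝓒) = E[c(K) · (ρ(K) + σ(K) · ζ(K))]`.

Proof: the level sets `{K = W}` are determined by the edges touching `W` not at `b`
(`dependsOn_avoidCluster_eq`); the attachment by the edges from `b` into `W` and the avoidance by
the edges not touching `W` (independent, `prob_attach_inter_delAvoid`); `expect_tower`
(`ObsIndependence.lean`) on the pointwise identities `bH_Q_iff` / `Q_iff` of `RowC1AvoidComb.lean`.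
-/

namespace Summit.Ventures.PercRepro2

namespace RowC1

section TowerDefs

variable {V : Type*} {E : Type*}

/-- `K(ω) = C_{G−b}(a₂)`: the cluster of `a₂` with every edge at `b` closed. -/
def avoidCluster (ends : E → Sym2 V) (b a₂ : V) (ω : Config E) : Set V :=
  cluster ends (delConfig ends {b} ω) a₂

/-- `{some edge from b into W is open}`. -/
def attachEvent (ends : E → Sym2 V) (b : V) (W : Set V) : Set (Config E) :=
  {ω | ∃ w ∈ W, OpenAdj ends ω b w}

/-- `{b ↮ a₁ in G − W}`. -/
def delAvoidEvent (ends : E → Sym2 V) (W : Set V) (b a₁ : V) : Set (Config E) :=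
  {ω | ¬ Conn ends (delConfig ends W ω) b a₁}

variable {ends : E → Sym2 V}

/-- The attachment event is monotone in `W`. -/
lemma attachEvent_mono (b : V) {W W' : Set V} (h : W ⊆ W') :
    attachEvent ends b W ⊆ attachEvent ends b W' :=
  fun _ ⟨w, hw, hbw⟩ => ⟨w, h hw, hbw⟩

/-- The avoidance event `{b ↮ a₁ in G − W}` is monotone in `W`. -/
lemma delAvoidEvent_mono (b a₁ : V) {W W' : Set V} (h : W ⊆ W') :
    delAvoidEvent ends W b a₁ ⊆ delAvoidEvent ends W' b a₁ :=
  fun _ hω hc => hω (conn_mono (delConfig_anti h _) hc)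

/-- `attachEvent` is determined by the edges from `b` into `W`. -/
lemma dependsOn_attachEvent (b : V) (W : Set V) :
    DependsOn (· ∈ attachEvent ends b W) (touches ends {b} ∩ touches ends W) := by
  intro ω ω' h
  apply propext
  constructor
  · rintro ⟨w, hw, e, he, hends⟩
    refine ⟨w, hw, e, ?_, hends⟩
    rw [← h e ⟨mem_touches_of_ends hends (Or.inl rfl), mem_touches_of_ends hends (Or.inr hw)⟩]
    exact he
  · rintro ⟨w, hw, e, he, hends⟩
    refine ⟨w, hw, e, ?_, hends⟩
    rw [h e ⟨mem_touches_of_ends hends (Or.inl rfl), mem_touches_of_ends hends (Or.inr hw)⟩]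
    exact he

/-- `delAvoidEvent` is determined by the edges not touching `W`. -/
lemma dependsOn_delAvoidEvent (W : Set V) (b a₁ : V) :
    DependsOn (· ∈ delAvoidEvent ends W b a₁) (touches ends W)ᶜ := by
  intro ω ω' h
  show (¬ Conn ends (delConfig ends W ω) b a₁) = (¬ Conn ends (delConfig ends W ω') b a₁)
  rw [delConfig_congr h]

/-- The level sets of `K` are determined by the edges touching `W` that are not at `b`. -/
lemma dependsOn_avoidCluster_eq (b a₂ : V) (W : Set V) :
    DependsOn (· ∈ {ω | avoidCluster ends b a₂ ω = W}) (touches ends W \ touches ends {b}) := by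
  intro ω ω' h
  have hagree : ∀ e ∈ touches ends W, delConfig ends {b} ω e = delConfig ends {b} ω' e := by
    intro e he
    by_cases hb : e ∈ touches ends {b}
    · rw [delConfig_apply_of_mem hb, delConfig_apply_of_mem hb]
    · rw [delConfig_apply_of_notMem hb, delConfig_apply_of_notMem hb]
      exact h e ⟨he, hb⟩
  exact propext ⟨cluster_eq_of_eqOn_touches hagree,
    cluster_eq_of_eqOn_touches fun e he => (hagree e he).symm⟩

/-- The edges from `b` into `W` and the edges not touching `W` are disjoint. -/
lemma disjoint_attach_delAvoid (b : V) (W : Set V) :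
    Disjoint (touches ends {b} ∩ touches ends W) (touches ends W)ᶜ := by
  rw [Set.disjoint_left]
  rintro e ⟨-, hW⟩ hW'
  exact hW' hW

/-- The edges at `b` and the edges not touching `W` avoid the edges determining `K` on `W`. -/
lemma union_subset_compl_sdiff (b : V) (W : Set V) :
    touches ends {b} ∪ (touches ends W)ᶜ ⊆ (touches ends W \ touches ends {b})ᶜ := by
  rintro e (hb | hW) ⟨hW', hb'⟩
  · exact hb' hb
  · exact hW hW'

end TowerDefs

section TowerProb

variable {V : Type*} {E : Type*} [Fintype E] [DecidableEq E] {R : Type*} [CommRing R]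

/-- `σ(W) = P(some edge from b into W is open)`. -/
noncomputable def attachProb (p : E → R) (ends : E → Sym2 V) (b : V) (W : Set V) : R :=
  prob p (attachEvent ends b W)

/-- `ρ(W) = P(no edge from b into W is open) = 1 − σ(W)`. -/
noncomputable def noAttachProb (p : E → R) (ends : E → Sym2 V) (b : V) (W : Set V) : R :=
  prob p (attachEvent ends b W)ᶜ

/-- `ζ(W) = P(b ↮ a₁ in G − W)`. -/
noncomputable def delAvoidProb (p : E → R) (ends : E → Sym2 V) (b a₁ : V) (W : Set V) : R :=
  prob p (delAvoidEvent ends W b a₁)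

/-- Independence of the attachment and the avoidance: `P(attach ∩ delAvoid) = σ · ζ`. -/
lemma prob_attach_inter_delAvoid (p : E → R) (ends : E → Sym2 V) (b a₁ : V) (W : Set V) :
    prob p (attachEvent ends b W ∩ delAvoidEvent ends W b a₁) =
      attachProb p ends b W * delAvoidProb p ends b a₁ W :=
  prob_inter_eq_mul_of_dependsOn p (disjoint_attach_delAvoid b W) (dependsOn_attachEvent b W)
    (dependsOn_delAvoidEvent W b a₁)

/-- `P(attachᶜ ∪ (attach ∩ delAvoid)) = ρ + σ · ζ`. -/
lemma prob_Q_fibre (p : E → R) (ends : E → Sym2 V) (b a₁ : V) (W : Set V) :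
    prob p ((attachEvent ends b W)ᶜ ∪ (attachEvent ends b W ∩ delAvoidEvent ends W b a₁)) =
      noAttachProb p ends b W + attachProb p ends b W * delAvoidProb p ends b a₁ W := by
  rw [prob_union_of_disjoint p, prob_attach_inter_delAvoid]
  · rfl
  · rw [Set.disjoint_left]
    rintro ω hω ⟨hω', -⟩
    exact hω hω'

/-- The coefficient `c(W) = 1_𝓒(W) · 1[a₁ ∉ W]`. -/
noncomputable def coeffK (𝓒 : Set (Set V)) (a₁ : V) (W : Set V) : R :=
  𝓒.indicator 1 W * ({W' : Set V | a₁ ∉ W'} : Set (Set V)).indicator 1 W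

omit [Fintype E] [DecidableEq E] in
/-- An indicator of a three-fold condition as a product of indicators. -/
lemma indicator_eq_coeff_mul {A : Set (Config E)} {𝓒 : Set (Set V)} {a₁ : V} {W : Set V}
    {B : Set (Config E)} {ω : Config E} (hiff : ω ∈ A ↔ (W ∈ 𝓒 ∧ a₁ ∉ W ∧ ω ∈ B)) :
    A.indicator (1 : Config E → R) ω = coeffK 𝓒 a₁ W * B.indicator 1 ω := by
  unfold coeffK
  by_cases h1 : W ∈ 𝓒 <;> by_cases h2 : a₁ ∉ W <;> by_cases h3 : ω ∈ B <;>
    simp [h1, h2, h3, hiff]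

omit [Fintype E] [DecidableEq E] in
/-- The dependency of the fibre observable `c(W) · 1_B(ω)` on the edges not determining `K`. -/
lemma dependsOn_fibreObs (ends : E → Sym2 V) (b a₁ : V) (𝓒 : Set (Set V)) (W : Set V)
    {B : Set (Config E)} (hB : DependsOn (· ∈ B) (touches ends {b} ∪ (touches ends W)ᶜ)) :
    DependsOn (fun ω => coeffK (R := R) 𝓒 a₁ W * B.indicator 1 ω)
      (touches ends W \ touches ends {b})ᶜ := by
  refine DependsOn.mono (union_subset_compl_sdiff b W) ?_
  intro ω ω' h
  simp only
  congr 1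
  exact dependsOn_indicator (R := R) hB h

end TowerProb

section Tower

variable {V : Type*} {E : Type*} [Fintype E] [DecidableEq E] [Fintype V]
  {R : Type*} [CommRing R]

/-- **Tower identity for `Q ∩ {b ∈ C₂}`**: for every family `𝓒` of vertex sets and `a₂ ≠ b`,
`P(Q, b ∈ C₂, K ∈ 𝓒) = E[1_𝓒(K) · 1[a₁ ∉ K] · σ(K) · ζ(K)]`. -/
theorem prob_bH_Q_eq_expect (p : E → R) (ends : E → Sym2 V) (a₁ a₂ b : V) (hne : a₂ ≠ b)
    (𝓒 : Set (Set V)) :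
    prob p (connEvent ends a₂ b ∩ (connEvent ends a₁ a₂)ᶜ ∩ {ω | avoidCluster ends b a₂ ω ∈ 𝓒}) =
      expect p (fun ω => coeffK 𝓒 a₁ (avoidCluster ends b a₂ ω) *
        (attachProb p ends b (avoidCluster ends b a₂ ω) *
          delAvoidProb p ends b a₁ (avoidCluster ends b a₂ ω))) := by
  classical
  let Φ : Set V → Config E → R := fun W ω =>
    coeffK 𝓒 a₁ W * (attachEvent ends b W ∩ delAvoidEvent ends W b a₁).indicator 1 ω
  have hpt : ∀ ω, (connEvent ends a₂ b ∩ (connEvent ends a₁ a₂)ᶜ ∩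
      {ω | avoidCluster ends b a₂ ω ∈ 𝓒}).indicator (1 : Config E → R) ω =
      Φ (avoidCluster ends b a₂ ω) ω := by
    intro ω
    refine indicator_eq_coeff_mul ?_
    simp only [Set.mem_inter_iff, Set.mem_compl_iff, Set.mem_setOf_eq, mem_connEvent]
    rw [and_comm, and_congr_right_iff]
    intro _
    exact (bH_Q_iff hne).trans (by
      simp only [avoidCluster, attachEvent, delAvoidEvent, Set.mem_setOf_eq])
  have hΦ : ∀ W, DependsOn (Φ W) (touches ends W \ touches ends {b})ᶜ := by
    intro W
    refine dependsOn_fibreObs ends b a₁ 𝓒 W ?_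
    exact dependsOn_inter ((dependsOn_attachEvent b W).mono Set.inter_subset_left)
      (dependsOn_delAvoidEvent W b a₁)
  have hS : ∀ W : Set V, DependsOn (· ∈ {ω | avoidCluster ends b a₂ ω = W})
      (touches ends W \ touches ends {b}) := fun W => dependsOn_avoidCluster_eq b a₂ W
  have hdisj : ∀ W : Set V, Disjoint (touches ends W \ touches ends {b})
      (touches ends W \ touches ends {b})ᶜ := fun W => disjoint_compl_right
  have hΦexp : ∀ W, expect p (Φ W) = coeffK 𝓒 a₁ W *
      (attachProb p ends b W * delAvoidProb p ends b a₁ W) := by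
    intro W
    simp only [Φ]
    rw [expect_const_mul, ← prob_eq_expect_indicator, prob_attach_inter_delAvoid]
  rw [prob_eq_expect_indicator]
  have e1 : (connEvent ends a₂ b ∩ (connEvent ends a₁ a₂)ᶜ ∩
      {ω | avoidCluster ends b a₂ ω ∈ 𝓒}).indicator (1 : Config E → R) =
      fun ω => Φ (avoidCluster ends b a₂ ω) ω := funext hpt
  rw [e1, expect_tower p hdisj (S := fun ω => avoidCluster ends b a₂ ω) hS hΦ]
  simp only [hΦexp]
  rfl

/-- **Tower identity for `Q`**: for every family `𝓒` and `a₂ ≠ b`,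
`P(Q, K ∈ 𝓒) = E[1_𝓒(K) · 1[a₁ ∉ K] · (ρ(K) + σ(K) · ζ(K))]`. -/
theorem prob_Q_eq_expect (p : E → R) (ends : E → Sym2 V) (a₁ a₂ b : V) (hne : a₂ ≠ b)
    (𝓒 : Set (Set V)) :
    prob p ((connEvent ends a₁ a₂)ᶜ ∩ {ω | avoidCluster ends b a₂ ω ∈ 𝓒}) =
      expect p (fun ω => coeffK 𝓒 a₁ (avoidCluster ends b a₂ ω) *
        (noAttachProb p ends b (avoidCluster ends b a₂ ω) +
          attachProb p ends b (avoidCluster ends b a₂ ω) *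
            delAvoidProb p ends b a₁ (avoidCluster ends b a₂ ω))) := by
  classical
  let Φ : Set V → Config E → R := fun W ω =>
    coeffK 𝓒 a₁ W *
      ((attachEvent ends b W)ᶜ ∪ (attachEvent ends b W ∩ delAvoidEvent ends W b a₁)).indicator 1 ω
  have hQ' : ∀ ω, (ω ∈ (connEvent ends a₁ a₂)ᶜ) ↔ (a₁ ∉ avoidCluster ends b a₂ ω ∧
      ω ∈ (attachEvent ends b (avoidCluster ends b a₂ ω))ᶜ ∪
        (attachEvent ends b (avoidCluster ends b a₂ ω) ∩
          delAvoidEvent ends (avoidCluster ends b a₂ ω) b a₁)) := by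
    intro ω
    rw [Set.mem_compl_iff, mem_connEvent, Q_iff hne]
    simp only [avoidCluster, attachEvent, delAvoidEvent, Set.mem_union, Set.mem_inter_iff,
      Set.mem_compl_iff, Set.mem_setOf_eq]
    constructor
    · rintro ⟨h1, h2⟩
      refine ⟨h1, ?_⟩
      by_cases hA : ∃ w ∈ cluster ends (delConfig ends {b} ω) a₂, OpenAdj ends ω b w
      · exact Or.inr ⟨hA, h2.resolve_left (not_not.2 hA)⟩
      · exact Or.inl hA
    · rintro ⟨h1, (h2 | ⟨-, h2⟩)⟩
      · exact ⟨h1, Or.inl h2⟩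
      · exact ⟨h1, Or.inr h2⟩
  have hpt : ∀ ω, ((connEvent ends a₁ a₂)ᶜ ∩
      {ω | avoidCluster ends b a₂ ω ∈ 𝓒}).indicator (1 : Config E → R) ω =
      Φ (avoidCluster ends b a₂ ω) ω := by
    intro ω
    refine indicator_eq_coeff_mul ?_
    simp only [Set.mem_inter_iff, Set.mem_setOf_eq]
    rw [and_comm, and_congr_right_iff]
    intro _
    exact hQ' ω
  have hΦ : ∀ W, DependsOn (Φ W) (touches ends W \ touches ends {b})ᶜ := by
    intro W
    refine dependsOn_fibreObs ends b a₁ 𝓒 W ?_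
    have h1 : DependsOn (· ∈ (attachEvent ends b W)ᶜ) (touches ends {b}) :=
      (dependsOn_compl (dependsOn_attachEvent b W)).mono Set.inter_subset_left
    have h2 : DependsOn (· ∈ attachEvent ends b W ∩ delAvoidEvent ends W b a₁)
        (touches ends {b} ∪ (touches ends W)ᶜ) :=
      dependsOn_inter ((dependsOn_attachEvent b W).mono Set.inter_subset_left)
        (dependsOn_delAvoidEvent W b a₁)
    exact (dependsOn_union h1 h2).mono (by
      rintro e (he | he)
      · exact Or.inl he
      · exact he)
  have hS : ∀ W : Set V, DependsOn (· ∈ {ω | avoidCluster ends b a₂ ω = W})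
      (touches ends W \ touches ends {b}) := fun W => dependsOn_avoidCluster_eq b a₂ W
  have hdisj : ∀ W : Set V, Disjoint (touches ends W \ touches ends {b})
      (touches ends W \ touches ends {b})ᶜ := fun W => disjoint_compl_right
  have hΦexp : ∀ W, expect p (Φ W) = coeffK 𝓒 a₁ W *
      (noAttachProb p ends b W + attachProb p ends b W * delAvoidProb p ends b a₁ W) := by
    intro W
    simp only [Φ]
    rw [expect_const_mul, ← prob_eq_expect_indicator, prob_Q_fibre]
  rw [prob_eq_expect_indicator]
  have e1 : ((connEvent ends a₁ a₂)ᶜ ∩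
      {ω | avoidCluster ends b a₂ ω ∈ 𝓒}).indicator (1 : Config E → R) =
      fun ω => Φ (avoidCluster ends b a₂ ω) ω := funext hpt
  rw [e1, expect_tower p hdisj (S := fun ω => avoidCluster ends b a₂ ω) hS hΦ]
  simp only [hΦexp]
  rfl

end Tower

end RowC1

end Summit.Ventures.PercRepro2
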